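import Mathlib
import HarnessLib
import Summits.ValiantsHypothesis.ValiantsHypothesis.Theorems.LacunarySymmetroidMatrixDescartesProductPlusOneSlowKneeCellRateFree
import Summits.ValiantsHypothesis.ValiantsHypothesis.Theorems.LacunarySymmetroidMatrixDescartesProductPlusOneCrossingInterlace

/-!
# LINE (A) `product_plus_one` (crux `MatrixDescartes`, stmt-ValiantsHypothesis-18050, V1) — the rate-free slow-knee cell in the FLOOR's currency:
# at most THREE zeros of `eulerNumerator d a l₀` in the window, for EVERY coupling `l₀`

Companion of ✓ `…SlowKneeCellRateFree` (★★ `slowKneeCellRateFree_wronskian_roots_le_two`: ≤ 2 roots of `W(∏ f_j)` in `(u,v)`) for the W-budget frame EB2-W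
(owner memo §14: `Z(eulerNumerator) ≤ Z(W) + 1` on a pole-free window, ✓ `eulerNumerator_roots_Icc_le_wronskian_roots_add_one`).  Same row menu (slow-pair binomials
with root outside `(u,v)`, binomial poles on `(d0,d2)`, `(d1,d2)` poles/knees by rate comparison, unswitched incoherent cloud rows), `0 < u`:

* `slowKneeCellRateFree_eval_ne_zero` — no row of the menu vanishes on `(u,v)`;
* `roots_Ioo_card_le_of_Icc` — counting shell: a bound for the roots of `R` on every closed `[u',v'] ⊂ (u,v)` bounds the roots in `(u,v)`;
* ★★ `slowKneeCellRateFree_eulerNumerator_roots_le_three` — for every coupling `l₀`,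
  `#{t ∈ (u,v) : eulerNumerator d a l₀ (t) = 0} ≤ 3` (`eulerNumerator` unfolded as in ✓ `…CrossingInterlace`).

Honest framing: the floor-currency count of ONE W-cell (helper); `OneChangeFloorK3` / `WronskianBudgetK3` / `stub_classRowK3` / `stub_polyLaw` / `MatrixDescartes` / B NOT
proved; `VP ≠ VNP` NOT proved.  No definitions, no named facts.
-/

set_option linter.dupNamespace false

namespace Summit.ValiantsHypothesis.ValiantsHypothesis.Theorems.LacunarySymmetroidMatrixDescartes

namespace ProductPlusOne

open Finset Set Polynomial
open scoped BigOperators Topology Polynomial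

/-- **No row of the rate-free menu vanishes on the window.** [this file's lemma] -/
theorem slowKneeCellRateFree_eval_ne_zero {m : ℕ} (d : Fin 3 → ℕ) (h01 : d 0 < d 1) (h12 : d 1 < d 2)
    (a : Fin m → Fin 3 → ℝ) {u v : ℝ} (hu : 0 < u)
    (hrow : ∀ j,
      (a j 2 = 0 ∧ a j 0 ≠ 0 ∧ a j 1 ≠ 0 ∧
          0 ≤ (∑ l, C (a j l) * X ^ (d l) : ℝ[X]).eval u * (∑ l, C (a j l) * X ^ (d l) : ℝ[X]).eval v) ∨
      (a j 1 = 0 ∧ a j 0 * a j 2 < 0 ∧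
          0 ≤ (∑ l, C (a j l) * X ^ (d l) : ℝ[X]).eval u * (∑ l, C (a j l) * X ^ (d l) : ℝ[X]).eval v) ∨
      (a j 0 = 0 ∧ a j 1 * a j 2 < 0 ∧ d 1 - d 0 ≤ d 2 - d 1 ∧
          0 ≤ (∑ l, C (a j l) * X ^ (d l) : ℝ[X]).eval u * (∑ l, C (a j l) * X ^ (d l) : ℝ[X]).eval v) ∨
      (a j 0 = 0 ∧ 0 < a j 1 * a j 2 ∧ d 2 - d 1 ≤ d 1 - d 0) ∨
      (0 < a j 0 ∧ a j 1 ≤ 0 ∧ a j 2 ≤ 0 ∧ a j 1 + a j 2 < 0 ∧ 0 < (∑ l, C (a j l) * X ^ (d l) : ℝ[X]).eval v))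
    {x : ℝ} (hx : x ∈ Ioo u v) (j : Fin m) : (∑ l, C (a j l) * X ^ (d l) : ℝ[X]).eval x ≠ 0 := by
  obtain ⟨e₁, he₁⟩ := Nat.exists_eq_add_of_lt h01
  obtain ⟨e₂, he₂⟩ := Nat.exists_eq_add_of_lt h12
  have hd := fin3_support_eq_gaps d e₁ e₂ he₁ he₂
  have hev : ∀ j x, (∑ l, C (a j l) * X ^ (d l) : ℝ[X]).eval x
      = x ^ (d 0) * (a j 0 + a j 1 * x ^ (e₁ + 1) + a j 2 * x ^ (e₁ + e₂ + 2)) := by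
    intro j x
    have h := (eval_trinomial_three (d 0) (e₁ + 1) (e₁ + e₂ + 2) (a j) x).1
    rw [hd] at h; rw [h]; ring
  have hv : 0 < v := hu.trans (hx.1.trans hx.2)
  have hx0 : 0 < x := hu.trans hx.1
  have hstrip : 0 ≤ (∑ l, C (a j l) * X ^ (d l) : ℝ[X]).eval u * (∑ l, C (a j l) * X ^ (d l) : ℝ[X]).eval v →
      0 ≤ (a j 0 + a j 1 * u ^ (e₁ + 1) + a j 2 * u ^ (e₁ + e₂ + 2)) * (a j 0 + a j 1 * v ^ (e₁ + 1) + a j 2 * v ^ (e₁ + e₂ + 2)) := by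
    intro h
    rw [hev, hev] at h
    have hpow : 0 < u ^ (d 0) * v ^ (d 0) := mul_pos (pow_pos hu _) (pow_pos hv _)
    have : u ^ (d 0) * (a j 0 + a j 1 * u ^ (e₁ + 1) + a j 2 * u ^ (e₁ + e₂ + 2))
        * (v ^ (d 0) * (a j 0 + a j 1 * v ^ (e₁ + 1) + a j 2 * v ^ (e₁ + e₂ + 2)))
        = (u ^ (d 0) * v ^ (d 0)) * ((a j 0 + a j 1 * u ^ (e₁ + 1) + a j 2 * u ^ (e₁ + e₂ + 2))
          * (a j 0 + a j 1 * v ^ (e₁ + 1) + a j 2 * v ^ (e₁ + e₂ + 2))) := by ring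
    rw [this] at h
    exact (mul_nonneg_iff_of_pos_left hpow).1 h
  rw [hev]
  refine mul_ne_zero (pow_ne_zero _ hx0.ne') ?_
  rcases hrow j with ⟨h2, _, h1, hend⟩ | ⟨h1, h02, hend⟩ | ⟨h0, h12s, _, hend⟩ | ⟨h0, h12s, _⟩ | ⟨_, h1, h2, _, hvpos⟩
  · have hg := hstrip hend
    rw [h2] at hg ⊢
    simp only [zero_mul, add_zero] at hg ⊢
    exact binomial_ne_zero_of_endpoints (a j 0) (a j 1) (Nat.succ_ne_zero e₁) hu hx hg h1
  · have hg := hstrip hend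
    have ha2 : a j 2 ≠ 0 := by rintro h; rw [h, mul_zero] at h02; exact lt_irrefl _ h02
    rw [h1] at hg ⊢
    simp only [zero_mul, add_zero] at hg ⊢
    exact binomial_ne_zero_of_endpoints (a j 0) (a j 2) (Nat.succ_ne_zero _) hu hx hg ha2
  · have hg := hstrip hend
    have ha2 : a j 2 ≠ 0 := by rintro h; rw [h, mul_zero] at h12s; exact lt_irrefl _ h12s
    rw [h0] at hg ⊢
    simp only [zero_add] at hg ⊢
    have hg' : 0 ≤ (a j 1 + a j 2 * u ^ (e₂ + 1)) * (a j 1 + a j 2 * v ^ (e₂ + 1)) := by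
      have hfac : (a j 1 * u ^ (e₁ + 1) + a j 2 * u ^ (e₁ + e₂ + 2)) * (a j 1 * v ^ (e₁ + 1) + a j 2 * v ^ (e₁ + e₂ + 2))
          = (u ^ (e₁ + 1) * v ^ (e₁ + 1)) * ((a j 1 + a j 2 * u ^ (e₂ + 1)) * (a j 1 + a j 2 * v ^ (e₂ + 1))) := by ring
      rw [hfac] at hg
      exact (mul_nonneg_iff_of_pos_left (mul_pos (pow_pos hu _) (pow_pos hv _))).1 hg
    have hne := binomial_ne_zero_of_endpoints (a j 1) (a j 2) (Nat.succ_ne_zero _) hu hx hg' ha2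
    have : a j 1 * x ^ (e₁ + 1) + a j 2 * x ^ (e₁ + e₂ + 2) = x ^ (e₁ + 1) * (a j 1 + a j 2 * x ^ (e₂ + 1)) := by ring
    rw [this]; exact mul_ne_zero (pow_ne_zero _ hx0.ne') hne
  · rw [h0, zero_add]
    have : a j 1 * x ^ (e₁ + 1) + a j 2 * x ^ (e₁ + e₂ + 2) = x ^ (e₁ + 1) * (a j 1 + a j 2 * x ^ (e₂ + 1)) := by ring
    rw [this]
    refine mul_ne_zero (pow_ne_zero _ hx0.ne') fun h => ?_
    have h' : a j 1 * a j 1 + a j 1 * a j 2 * x ^ (e₂ + 1) = 0 := by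
      have : a j 1 * (a j 1 + a j 2 * x ^ (e₂ + 1)) = 0 := by rw [h, mul_zero]
      linarith [this]
    nlinarith [mul_self_nonneg (a j 1), mul_pos h12s (pow_pos hx0 (e₂ + 1))]
  · rw [hev] at hvpos
    have h3 : 0 < a j 0 + a j 1 * v ^ (e₁ + 1) + a j 2 * v ^ (e₁ + e₂ + 2) := (mul_pos_iff_of_pos_left (pow_pos hv _)).1 hvpos
    have hm1 : a j 1 * v ^ (e₁ + 1) ≤ a j 1 * x ^ (e₁ + 1) :=
      mul_le_mul_of_nonpos_left (pow_le_pow_left₀ hx0.le hx.2.le _) h1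
    have hm2 : a j 2 * v ^ (e₁ + e₂ + 2) ≤ a j 2 * x ^ (e₁ + e₂ + 2) :=
      mul_le_mul_of_nonpos_left (pow_le_pow_left₀ hx0.le hx.2.le _) h2
    exact ne_of_gt (by linarith)

/-- **Counting shell**: if for every closed `[u',v'] ⊂ (u,v)` the roots of `R` in `[u',v']` number at most `N`, then the roots of `R` in `(u,v)` number
at most `N`. [folklore] -/
theorem roots_Ioo_card_le_of_Icc (R : ℝ[X]) {u v : ℝ} (N : ℕ)
    (h : ∀ u' v', u < u' → v' < v → (R.roots.toFinset.filter (fun t => u' ≤ t ∧ t ≤ v')).card ≤ N) :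
    (R.roots.toFinset.filter (fun t => u < t ∧ t < v)).card ≤ N := by
  classical
  set T := R.roots.toFinset.filter (fun t => u < t ∧ t < v) with hT
  rcases T.eq_empty_or_nonempty with hE | hne
  · rw [hE, Finset.card_empty]; exact Nat.zero_le _
  · have hmin := T.min'_mem hne
    have hmax := T.max'_mem hne
    have hmin' := (Finset.mem_filter.1 hmin).2
    have hmax' := (Finset.mem_filter.1 hmax).2
    refine le_trans (Finset.card_le_card fun t ht => ?_) (h (T.min' hne) (T.max' hne) hmin'.1 hmax'.2)
    have ht' := Finset.mem_filter.1 ht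
    exact Finset.mem_filter.2 ⟨ht'.1, T.min'_le t ht, T.le_max' t ht⟩

/-- ★★ **THE RATE-FREE SLOW-KNEE CELL IN THE FLOOR'S CURRENCY**: for every coupling `l₀`, `eulerNumerator d a l₀` (unfolded) has AT MOST THREE zeros in
`(u,v)`. [this file's theorem] -/
theorem slowKneeCellRateFree_eulerNumerator_roots_le_three {m : ℕ} (d : Fin 3 → ℕ) (h01 : d 0 < d 1) (h12 : d 1 < d 2)
    (a : Fin m → Fin 3 → ℝ) (l₀ : Fin 3) {u v : ℝ} (hu : 0 < u)
    (hrow : ∀ j,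
      (a j 2 = 0 ∧ a j 0 ≠ 0 ∧ a j 1 ≠ 0 ∧
          0 ≤ (∑ l, C (a j l) * X ^ (d l) : ℝ[X]).eval u * (∑ l, C (a j l) * X ^ (d l) : ℝ[X]).eval v) ∨
      (a j 1 = 0 ∧ a j 0 * a j 2 < 0 ∧
          0 ≤ (∑ l, C (a j l) * X ^ (d l) : ℝ[X]).eval u * (∑ l, C (a j l) * X ^ (d l) : ℝ[X]).eval v) ∨
      (a j 0 = 0 ∧ a j 1 * a j 2 < 0 ∧ d 1 - d 0 ≤ d 2 - d 1 ∧
          0 ≤ (∑ l, C (a j l) * X ^ (d l) : ℝ[X]).eval u * (∑ l, C (a j l) * X ^ (d l) : ℝ[X]).eval v) ∨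
      (a j 0 = 0 ∧ 0 < a j 1 * a j 2 ∧ d 2 - d 1 ≤ d 1 - d 0) ∨
      (0 < a j 0 ∧ a j 1 ≤ 0 ∧ a j 2 ≤ 0 ∧ a j 1 + a j 2 < 0 ∧ 0 < (∑ l, C (a j l) * X ^ (d l) : ℝ[X]).eval v)) :
    ((∑ j, (∑ l, C (a j l * ((d l : ℝ) - d l₀)) * X ^ (d l)) * ∏ i ∈ Finset.univ.erase j, (∑ l, C (a i l) * X ^ (d l))
        : ℝ[X]).roots.toFinset.filter (fun t => u < t ∧ t < v)).card ≤ 3 := by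
  classical
  refine roots_Ioo_card_le_of_Icc _ 3 fun u' v' hu' hv' => ?_
  rcases lt_or_ge v' u' with hvu | huv'
  · have : ((∑ j, (∑ l, C (a j l * ((d l : ℝ) - d l₀)) * X ^ (d l)) * ∏ i ∈ Finset.univ.erase j, (∑ l, C (a i l) * X ^ (d l))
        : ℝ[X]).roots.toFinset.filter (fun t => u' ≤ t ∧ t ≤ v')) = ∅ :=
      Finset.filter_eq_empty_iff.2 fun t _ h => by linarith [h.1, h.2]
    rw [this]; simp
  have hu'0 : 0 < u' := hu.trans hu'
  have hP : ∀ t ∈ Set.Icc u' v', (∏ j, (∑ l, C (a j l) * X ^ (d l) : ℝ[X])).eval t ≠ 0 := by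
    intro t ht
    rw [eval_prod]
    exact Finset.prod_ne_zero_iff.2 fun j _ =>
      slowKneeCellRateFree_eval_ne_zero d h01 h12 a hu hrow ⟨hu'.trans_le ht.1, ht.2.trans_lt hv'⟩ j
  have h1 := eulerNumerator_roots_Icc_le_wronskian_roots_add_one d a l₀ hu'0 hP
  have h2 := slowKneeCellRateFree_wronskian_roots_le_two d h01 h12 a hu hrow
  -- the W-roots in `(u',v')` are among those in `(u,v)`
  have h3 : (((∏ j, ∑ l, C (a j l) * X ^ (d l) : ℝ[X]) * (X * derivative (X * derivative (∏ j, ∑ l, C (a j l) * X ^ (d l) : ℝ[X])))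
            - (X * derivative (∏ j, ∑ l, C (a j l) * X ^ (d l) : ℝ[X])) ^ 2).roots.toFinset.filter (fun w => u' < w ∧ w < v')).card
      ≤ (((∏ j, ∑ l, C (a j l) * X ^ (d l) : ℝ[X]) * (X * derivative (X * derivative (∏ j, ∑ l, C (a j l) * X ^ (d l) : ℝ[X])))
            - (X * derivative (∏ j, ∑ l, C (a j l) * X ^ (d l) : ℝ[X])) ^ 2).roots.toFinset.filter (fun t => u < t ∧ t < v)).card := by
    refine Finset.card_le_card fun t ht => ?_
    have ht' := Finset.mem_filter.1 ht
    exact Finset.mem_filter.2 ⟨ht'.1, hu'.trans ht'.2.1, ht'.2.2.trans hv'⟩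
  omega

end ProductPlusOne

end Summit.ValiantsHypothesis.ValiantsHypothesis.Theorems.LacunarySymmetroidMatrixDescartes
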